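import Summits.AtomisticToContinuum.HydrodynamicLimit.Theorems.CollisionIsometryCLTAdaptedWeightCLTCBEqRungGibbs
import Summits.AtomisticToContinuum.HydrodynamicLimit.Theorems.CollisionIsometryCLTAdaptedWeightCLTCBTimeZero
import Summits.AtomisticToContinuum.HydrodynamicLimit.Theorems.JParityClosureOddContactSymmetryGibbsInvariance
import Summits.AtomisticToContinuum.HydrodynamicLimit.Theorems.CollisionIsometryCLTCollisionalTransferLocalityTimeIntegralInProbability
import Summits.AtomisticToContinuum.HydrodynamicLimit.Theorems.CollisionIsometryCLTCollisionalTransferLocalityFlowMeasurable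

/-!
# Equilibrium rung of the crux `AdaptedWeightCLT` (stmt-AtomisticToContinuum-14868), line `Sketch`:
# the crux's conclusion at constant profiles, for every horizon and every flow family

Support file (`--supports stmt-AtomisticToContinuum-14868`, anchor `eqRung_anchor`) of the line lead
`prover-line-stmt-AtomisticToContinuum-14868-c3-0`; final file of the EQUILIBRIUM RUNG. MAIN RESULT
(`conclOn_const`): for constant profiles `(a₀, θ₀, u₀) ≡ (a, θ, u)` with `0 < a`, `0 < θ`, every
`0 < σ < 1/2`, every hard-sphere flow family `Φ` and every `t > 0`,

  `ConclOn σ (fun _ => a) (fun _ => θ) (fun _ => u) Φ t`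

— the crux's conclusion on `[0, t]` (for every admissible kernel family and `δ > 0`,
`P_N{δ < ∫₀ᵗ∫ₓ Σ_{jk} D_{jk}² + |q|²} → 0` under the local Gibbs law) holds UNCONDITIONALLY: no diffuse
backward influence (H1) and no a-priori tail bound (H2) are needed at equilibrium. This is the `m = 0` rung of
the crux along the deterministic dynamics and the equilibrium consistency check of the route
(`Theses/CollisionIsometryCLT.lean`, CHEAPEST FALSIFIER (v)).

Proof. The local Gibbs law at constant profiles is invariant under every flow map (tree:
`measurePreserving_flow_localGibbsLaw_const` — Liouville + conservation of energy and momentum), so every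
time slice of the crux functional has the STATIC law: its mean is `≤ b_N → 0` (`exists_lintegral_anisC_le` with
the admissible kernel bounds and the density cap `TimeZero.density_cap`: `b_N = O((N+1)^{(3γ−1)/4})`), its
second moment is bounded uniformly (`TimeZero.anisC_le`, Jensen `expMoment(λ/2)² ≤ expMoment(λ)`, and the
Gaussian exponential moments `localGibbs_expVelocityMoment_le`); Markov gives convergence in probability of
every slice, and the generic time-integral glue `tendsto_measure_setIntegral_of_forall` (tree, crux 9518's
equilibrium rung) — applied to the jointly measurable modification of the flow (`measurable_flowMod`) and to
the sequence shifted past the two thresholds — gives the time integral; on the good set the modification is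
the flow, and the good set is conull. No definitions are introduced (pure proof file).

References: H. Spohn, *Large Scale Dynamics of Interacting Particles* (1991), Part I §2.3 (equilibrium
states are invariant; local equilibrium LLN) [Spohn1991].
-/

namespace Summit.AtomisticToContinuum.HydrodynamicLimit.Theorems.ContactBalance

open scoped BigOperators Topology Classical MeasureTheory ENNReal InnerProductSpace
open Filter Set MeasureTheory ProbabilityTheory
open Literature.Analysis.FluidPDE
open Summit.AtomisticToContinuum.HydrodynamicLimit.Theorems.ContactSourceDuhamel
open Summit.AtomisticToContinuum.HydrodynamicLimit.Theorems.ContactSourceDuhamel.TimeLocal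
open Literature.MathematicalPhysics.KineticTheory (gaussMeasure hsDiameter localGibbsLaw localGibbsLaw_eq
  localGibbsMeasure isProbabilityMeasure_localGibbsLaw isProbabilityMeasure_localGibbsMeasure
  localGibbsLaw_absolutelyContinuous)

noncomputable section

namespace EqRung

/-! ## Two elementary inputs -/

/-- Jensen for the exponential velocity moment: `expMoment(λ/2)² ≤ expMoment(λ)`
(`((N+1)⁻¹ Σ eᵢ)² ≤ (N+1)⁻¹ Σ eᵢ²`). -/
theorem expMoment_half_sq_le (lam : ℝ) (N : ℕ) (z : Cfg N) :
    PastDamping.expMoment (lam / 2) N z ^ 2 ≤ PastDamping.expMoment lam N z := by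
  unfold PastDamping.expMoment
  have hM : (0 : ℝ) < ((N + 1 : ℕ) : ℝ) := by positivity
  have hcs := sq_sum_le_card_mul_sum_sq (s := (Finset.univ : Finset (Fin (N + 1))))
    (f := fun i => Real.exp (lam / 2 * ‖(z i).2‖ ^ 2))
  simp only [Finset.card_univ, Fintype.card_fin] at hcs
  have hsq : ∀ i : Fin (N + 1), Real.exp (lam / 2 * ‖(z i).2‖ ^ 2) ^ 2 = Real.exp (lam * ‖(z i).2‖ ^ 2) := by
    intro i
    rw [sq, ← Real.exp_add]
    ring_nf
  simp_rw [hsq] at hcs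
  rw [mul_pow, inv_pow]
  calc (((N + 1 : ℕ) : ℝ) ^ 2)⁻¹ * (∑ i, Real.exp (lam / 2 * ‖(z i).2‖ ^ 2)) ^ 2
      ≤ (((N + 1 : ℕ) : ℝ) ^ 2)⁻¹ * (((N + 1 : ℕ) : ℝ) * ∑ i, Real.exp (lam * ‖(z i).2‖ ^ 2)) :=
        mul_le_mul_of_nonneg_left hcs (by positivity)
    _ = ((N + 1 : ℕ) : ℝ)⁻¹ * ∑ i, Real.exp (lam * ‖(z i).2‖ ^ 2) := by
        field_simp

/-- The rate `(C (N+1)^{3γ} / (N+1))^{1/4} → 0` for `3γ < 1`. -/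
theorem tendsto_kernel_rate {γ C : ℝ} (hγ3 : 3 * γ < 1) :
    Tendsto (fun N : ℕ => (C * ((N : ℝ) + 1) ^ (3 * γ) / ((N + 1 : ℕ) : ℝ)) ^ (1 / 4 : ℝ)) atTop (𝓝 0) := by
  have hcast : Tendsto (fun N : ℕ => ((N + 1 : ℕ) : ℝ)) atTop atTop :=
    tendsto_natCast_atTop_atTop.comp (tendsto_add_atTop_nat 1)
  have h1 : Tendsto (fun N : ℕ => C * ((N + 1 : ℕ) : ℝ) ^ (3 * γ - 1)) atTop (𝓝 (C * 0)) :=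
    ((tendsto_rpow_neg_atTop (by linarith : 0 < -(3 * γ - 1))).comp hcast |>.congr fun N => by
      simp).const_mul C
  rw [mul_zero] at h1
  have h2 : Tendsto (fun N : ℕ => (C * ((N + 1 : ℕ) : ℝ) ^ (3 * γ - 1)) ^ (1 / 4 : ℝ)) atTop (𝓝 0) := by
    have := h1.rpow_const (p := (1 / 4 : ℝ)) (Or.inr (by norm_num))
    rwa [Real.zero_rpow (by norm_num)] at this
  refine h2.congr fun N => ?_
  have hM : (0 : ℝ) < ((N + 1 : ℕ) : ℝ) := by positivity
  have hc : ((N : ℝ) + 1) = ((N + 1 : ℕ) : ℝ) := (Nat.cast_succ N).symm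
  rw [hc, Real.rpow_sub hM, Real.rpow_one, mul_div_assoc]

/-! ## The equilibrium rung -/

/-- **THE EQUILIBRIUM RUNG OF THE CRUX `AdaptedWeightCLT`.** At constant profiles `(a, θ, u)`, `0 < a`,
`0 < θ`, for every `0 < σ < 1/2`, every hard-sphere flow family and every `t > 0`, the crux's conclusion on
`[0, t]` holds: for every admissible kernel family and every `δ > 0`,
`P_N{δ < ∫₀ᵗ∫ₓ Σ D² + |q|²} → 0` under the local Gibbs law — unconditionally (neither H1 nor H2 is used). -/
theorem conclOn_const (a θ : ℝ) (u : V3) (ha : 0 < a) (hθ : 0 < θ) {σ : ℝ} (hσ : 0 < σ) (hσ' : σ < 2⁻¹)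
    (Φ : Flows σ) {t : ℝ} (ht : 0 < t) : ConclOn σ (fun _ => a) (fun _ => θ) (fun _ => u) Φ t := by
  refine SourceContraction.conclOn_of_tendsto_defect fun γ C φ hγ hγ' hadm δ hδ => ?_
  have hσ2 : σ ≤ 1 / 2 := by rw [one_div]; exact hσ'.le
  have hca : Continuous (fun _ : T3 => a) := continuous_const
  have hcθ : Continuous (fun _ : T3 => θ) := continuous_const
  have hcu : Continuous (fun _ : T3 => u) := continuous_const
  have hφc : ∀ N, Continuous (φ N) := fun N => (hadm.1 N).continuous
  have hφ0 : ∀ N y, 0 ≤ φ N y := hadm.2.1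
  have hφC : ∀ (N : ℕ) y, φ N y ≤ C * ((N : ℝ) + 1) ^ (3 * γ) := hadm.2.2.2.2.1
  have hC0 : 0 ≤ C := Pointwise.admissible_C_nonneg hadm
  -- the laws, the modified flow, the slices
  set G : (N : ℕ) → Measure (Cfg N) := fun N =>
    localGibbsLaw σ (fun _ => a) (fun _ => u) (fun _ => θ) N (Φ N) with hGdef
  set fm : (N : ℕ) → ℝ × Cfg N → Cfg N := fun N p =>
    if p.2 ∈ (Φ N).good then (Φ N).flow p.1 p.2 else p.2 with hfmdef
  set X : (N : ℕ) → ℝ → Cfg N → ℝ := fun N s z => anisC N φ (fm N (s, z)) with hXdef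
  haveI hprob : ∀ N, IsProbabilityMeasure (G N) := fun N =>
    isProbabilityMeasure_localGibbsLaw hca hcθ hcu (fun _ => ha) (fun _ => hθ) hσ2 N (Φ N)
  have hgood : ∀ N, G N (Φ N).goodᶜ = 0 := fun N =>
    localGibbsLaw_absolutelyContinuous σ _ _ _ N (Φ N) (Φ N).measure_compl_good
  have hfm_good : ∀ N s, ∀ z ∈ (Φ N).good, fm N (s, z) = (Φ N).flow s z := fun N s z hz => if_pos hz
  have hfm_meas : ∀ N, Measurable (fm N) := fun N => HemisphereAffineSlaving.measurable_flowMod Φ N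
  have hanis_meas : ∀ N, Measurable fun z : Cfg N => anisC N φ z := fun N => measurable_anisC (hφc N)
  have hXm : ∀ N, Measurable (Function.uncurry (X N)) := fun N => (hanis_meas N).comp (hfm_meas N)
  have hXs : ∀ N s, Measurable (X N s) := fun N s =>
    (hanis_meas N).comp ((hfm_meas N).comp (measurable_const.prodMk measurable_id))
  have hX0 : ∀ N s z, 0 ≤ X N s z := fun N s z => FreeStretch.anisC_nonneg φ _
  have hgoodae : ∀ N, ∀ᵐ z ∂G N, z ∈ (Φ N).good := by
    intro N
    filter_upwards [measure_eq_zero_iff_ae_notMem.1 (hgood N)] with z hz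
    simpa using hz
  have hXae : ∀ N s, (fun z => X N s z) =ᵐ[G N] fun z => anisC N φ ((Φ N).flow s z) := by
    intro N s
    filter_upwards [hgoodae N] with z hz
    simp only [hXdef, hfm_good N s z hz]
  -- static input 1: the mean of a slice is `≤ b_N → 0` (for `N ≥ N₀`)
  obtain ⟨K, hK, hKb⟩ := exists_lintegral_anisC_le u hθ
  obtain ⟨N₀, hcap⟩ := TimeZero.density_cap hadm hγ hγ' hσ hσ'
  set b : ℕ → ℝ≥0∞ := fun N => K * ENNReal.ofReal ((27 * C / σ ^ 3 + 1) ^ 2 *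
    (C * ((N : ℝ) + 1) ^ (3 * γ) / ((N + 1 : ℕ) : ℝ)) ^ (1 / 4 : ℝ)) with hbdef
  have hmean : ∀ N, N₀ ≤ N → ∫⁻ z, ENNReal.ofReal (anisC N φ z) ∂G N ≤ b N := by
    intro N hN
    have hprobM : IsProbabilityMeasure (localGibbsMeasure σ (fun _ => a) (fun _ => u) (fun _ => θ) N) :=
      isProbabilityMeasure_localGibbsMeasure hca hcθ hcu (fun _ => ha) (fun _ => hθ) hσ2 N
    have hwcap : (0 : ℝ) ≤ C * ((N : ℝ) + 1) ^ (3 * γ) := mul_nonneg hC0 (Real.rpow_nonneg (by positivity) _)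
    exact hKb N a σ (Φ N) φ ha.le (hφc N) (hφ0 N) _ hwcap (hφC N) _ (hcap N hN) hprobM
  have hb0 : Tendsto b atTop (𝓝 0) := by
    have h1 : Tendsto (fun N : ℕ => (27 * C / σ ^ 3 + 1) ^ 2 *
        (C * ((N : ℝ) + 1) ^ (3 * γ) / ((N + 1 : ℕ) : ℝ)) ^ (1 / 4 : ℝ)) atTop (𝓝 ((27 * C / σ ^ 3 + 1) ^ 2 * 0)) :=
      (tendsto_kernel_rate (by linarith)).const_mul _
    rw [mul_zero] at h1
    have h2 : Tendsto (fun N : ℕ => ENNReal.ofReal ((27 * C / σ ^ 3 + 1) ^ 2 *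
        (C * ((N : ℝ) + 1) ^ (3 * γ) / ((N + 1 : ℕ) : ℝ)) ^ (1 / 4 : ℝ))) atTop (𝓝 0) := by
      rw [← ENNReal.ofReal_zero]; exact ENNReal.tendsto_ofReal h1
    have h3 := ENNReal.Tendsto.const_mul h2 (Or.inr hK)
    rw [mul_zero] at h3
    exact h3
  -- static input 2: uniform second moments (for `N ≥ N₁`)
  obtain ⟨lam, hlam, Cexp, hCexp, hmom⟩ :=
    LambertianContactSwapLambertianEulerTailsZero.localGibbs_expVelocityMoment_le hca hcθ hcu
      (fun _ => ha) (fun _ => hθ) hσ2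
  obtain ⟨N₁, hanis⟩ := TimeZero.anisC_le hadm hγ hγ' hσ hσ' (half_pos hlam)
  set A : ℝ := (1152 * (((lam / 2) ^ 2)⁻¹ + ((lam / 2) ^ 3)⁻¹)) * (27 * C / σ ^ 3 + 1) with hAdef
  have hA0 : 0 ≤ A := by positivity
  have hsq : ∀ N, N₁ ≤ N → ∫⁻ z, ENNReal.ofReal (anisC N φ z ^ 2) ∂G N ≤ ENNReal.ofReal (A ^ 2) * Cexp := by
    intro N hN
    have hpt : ∀ᵐ z ∂G N, ENNReal.ofReal (anisC N φ z ^ 2) ≤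
        ENNReal.ofReal (A ^ 2) * Literature.Barriers.AtomisticToContinuum.expVelocityMoment lam z := by
      filter_upwards [hgoodae N] with z hz
      have hdom := (Φ N).good_subset hz
      have h1 := hanis N hN z hdom
      have h0 : 0 ≤ anisC N φ z := FreeStretch.anisC_nonneg φ z
      have h2 : anisC N φ z ^ 2 ≤ A ^ 2 * PastDamping.expMoment lam N z :=
        calc anisC N φ z ^ 2 ≤ (A * PastDamping.expMoment (lam / 2) N z) ^ 2 :=
              pow_le_pow_left₀ h0 h1 2
          _ = A ^ 2 * PastDamping.expMoment (lam / 2) N z ^ 2 := by ring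
          _ ≤ A ^ 2 * PastDamping.expMoment lam N z :=
              mul_le_mul_of_nonneg_left (expMoment_half_sq_le lam N z) (sq_nonneg _)
      rw [Literature.Barriers.AtomisticToContinuum.expVelocityMoment_eq, ← ENNReal.ofReal_mul (sq_nonneg _)]
      exact ENNReal.ofReal_le_ofReal h2
    calc ∫⁻ z, ENNReal.ofReal (anisC N φ z ^ 2) ∂G N
        ≤ ∫⁻ z, ENNReal.ofReal (A ^ 2) * Literature.Barriers.AtomisticToContinuum.expVelocityMoment lam z ∂G N :=
          lintegral_mono_ae hpt
      _ = ENNReal.ofReal (A ^ 2) * ∫⁻ z, Literature.Barriers.AtomisticToContinuum.expVelocityMoment lam z ∂G N := by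
          rw [lintegral_const_mul]
          exact (PastDamping.measurable_expMoment lam N).ennreal_ofReal
      _ ≤ ENNReal.ofReal (A ^ 2) * Cexp := mul_le_mul_right (hmom N (Φ N)) _
  -- thresholds, the shifted family
  set N₂ : ℕ := max N₀ N₁ with hN₂
  have hN₀ : ∀ n : ℕ, N₀ ≤ n + N₂ := fun n => (le_max_left _ _).trans (Nat.le_add_left _ _)
  have hN₁ : ∀ n : ℕ, N₁ ≤ n + N₂ := fun n => (le_max_right _ _).trans (Nat.le_add_left _ _)
  -- slices of the shifted family: second moments
  have hlin2 : ∀ (n : ℕ) (s : ℝ), ∫⁻ z, ENNReal.ofReal (X (n + N₂) s z ^ 2) ∂G (n + N₂) ≤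
      ENNReal.ofReal (A ^ 2) * Cexp := by
    intro n s
    set N := n + N₂
    have hcongr : (fun z => ENNReal.ofReal (X N s z ^ 2)) =ᵐ[G N]
        fun z => ENNReal.ofReal (anisC N φ ((Φ N).flow s z) ^ 2) := by
      filter_upwards [hXae N s] with z hz
      simp only [hz]
    calc ∫⁻ z, ENNReal.ofReal (X N s z ^ 2) ∂G N
        = ∫⁻ z, ENNReal.ofReal (anisC N φ ((Φ N).flow s z) ^ 2) ∂G N := lintegral_congr_ae hcongr
      _ = ∫⁻ z, ENNReal.ofReal (anisC N φ z ^ 2) ∂G N :=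
          lintegral_comp_flow_localGibbsLaw_const σ a θ u N (Φ N) s
            (g := fun w => ENNReal.ofReal (anisC N φ w ^ 2)) ((hanis_meas N).pow_const 2).ennreal_ofReal
      _ ≤ _ := hsq N (hN₁ n)
  have htop : ENNReal.ofReal (A ^ 2) * Cexp ≠ ⊤ := ENNReal.mul_ne_top ENNReal.ofReal_ne_top hCexp.ne
  have hint2 : ∀ (n : ℕ) (s : ℝ), Integrable (fun z => X (n + N₂) s z ^ 2) (G (n + N₂)) := by
    intro n s
    refine ⟨((hXs _ s).pow_const 2).aestronglyMeasurable, ?_⟩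
    rw [hasFiniteIntegral_iff_ofReal (ae_of_all _ fun z => sq_nonneg _)]
    exact (hlin2 n s).trans_lt (lt_top_iff_ne_top.2 htop)
  have hmemLp : ∀ (n : ℕ), ∀ s ∈ Icc 0 t, MemLp (X (n + N₂) s) 2 (G (n + N₂)) := fun n s _ =>
    (memLp_two_iff_integrable_sq (hXs _ s).aestronglyMeasurable).2 (hint2 n s)
  have hbound2 : ∀ (n : ℕ), ∀ s ∈ Icc 0 t, ∫ z, X (n + N₂) s z ^ 2 ∂G (n + N₂) ≤
      (ENNReal.ofReal (A ^ 2) * Cexp).toReal := by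
    intro n s _
    rw [integral_eq_lintegral_of_nonneg_ae (ae_of_all _ fun z => sq_nonneg _)
      ((hXs _ s).pow_const 2).aestronglyMeasurable]
    exact ENNReal.toReal_mono htop (hlin2 n s)
  -- slices of the shifted family: convergence in probability (Markov + invariance)
  have hslice : ∀ s ∈ Icc 0 t, ∀ δ' : ℝ, 0 < δ' →
      Tendsto (fun n : ℕ => G (n + N₂) {z | δ' < |X (n + N₂) s z|}) atTop (𝓝 0) := by
    intro s _ δ' hδ'
    have hle : ∀ n : ℕ, G (n + N₂) {z | δ' < |X (n + N₂) s z|} ≤ b (n + N₂) / ENNReal.ofReal δ' := by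
      intro n
      set N := n + N₂
      have hA : MeasurableSet {w : Cfg N | δ' < anisC N φ w} := measurableSet_lt measurable_const (hanis_meas N)
      have hincl : {z | δ' < |X N s z|} ⊆ (Φ N).flow s ⁻¹' {w | δ' < anisC N φ w} ∪ (Φ N).goodᶜ := by
        intro z hz
        by_cases hg : z ∈ (Φ N).good
        · left
          simp only [mem_setOf_eq] at hz
          rw [abs_of_nonneg (hX0 N s z)] at hz
          simp only [mem_preimage, mem_setOf_eq]
          simpa [hXdef, hfm_good N s z hg] using hz
        · right; exact hg
      have hmarkov : G N {w | δ' < anisC N φ w} ≤ b N / ENNReal.ofReal δ' := by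
        have hsub : {w : Cfg N | δ' < anisC N φ w} ⊆ {w | ENNReal.ofReal δ' ≤ ENNReal.ofReal (anisC N φ w)} :=
          fun w hw => ENNReal.ofReal_le_ofReal (le_of_lt hw)
        calc G N {w | δ' < anisC N φ w} ≤ G N {w | ENNReal.ofReal δ' ≤ ENNReal.ofReal (anisC N φ w)} :=
              measure_mono hsub
          _ ≤ (∫⁻ w, ENNReal.ofReal (anisC N φ w) ∂G N) / ENNReal.ofReal δ' :=
              meas_ge_le_lintegral_div (hanis_meas N).ennreal_ofReal.aemeasurable
                (ENNReal.ofReal_pos.2 hδ').ne' ENNReal.ofReal_ne_top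
          _ ≤ b N / ENNReal.ofReal δ' := ENNReal.div_le_div_right (hmean N (hN₀ n)) _
      calc G N {z | δ' < |X N s z|}
          ≤ G N ((Φ N).flow s ⁻¹' {w | δ' < anisC N φ w} ∪ (Φ N).goodᶜ) := measure_mono hincl
        _ ≤ G N ((Φ N).flow s ⁻¹' {w | δ' < anisC N φ w}) + G N (Φ N).goodᶜ := measure_union_le _ _
        _ = G N {w | δ' < anisC N φ w} := by
            rw [hgood N, add_zero]
            exact localGibbsLaw_const_preimage_flow σ a θ u N (Φ N) s hA
        _ ≤ b N / ENNReal.ofReal δ' := hmarkov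
    have hlim : Tendsto (fun n : ℕ => b (n + N₂) / ENNReal.ofReal δ') atTop (𝓝 0) := by
      have h1 : Tendsto (fun n : ℕ => b (n + N₂)) atTop (𝓝 0) := (tendsto_add_atTop_iff_nat N₂).2 hb0
      have h2 := ENNReal.Tendsto.div_const h1 (Or.inr (ENNReal.ofReal_pos.2 hδ').ne')
      rwa [ENNReal.zero_div] at h2
    exact tendsto_of_tendsto_of_tendsto_of_le_of_le' tendsto_const_nhds hlim
      (Eventually.of_forall fun n => bot_le) (Eventually.of_forall hle)
  -- the time-integral glue on the shifted family
  have hglue := HemisphereAffineSlaving.tendsto_measure_setIntegral_of_forall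
    (fun n => G (n + N₂)) (fun n => hprob (n + N₂)) ht.le (fun n => X (n + N₂)) (fun n => hXm (n + N₂))
    hmemLp hbound2 hslice δ hδ
  -- un-shift and compare the events on the good set
  have hev : ∀ N : ℕ, G N {z | δ < ∫ s in Icc 0 t, ∫ x, DefectSq σ N (Φ N) φ s z x} ≤
      G N {z | δ < |∫ s in Icc 0 t, X N s z|} := by
    intro N
    have hincl : {z | δ < ∫ s in Icc 0 t, ∫ x, DefectSq σ N (Φ N) φ s z x} ⊆
        {z | δ < |∫ s in Icc 0 t, X N s z|} ∪ (Φ N).goodᶜ := by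
      intro z hz
      by_cases hg : z ∈ (Φ N).good
      · left
        simp only [mem_setOf_eq] at hz ⊢
        have heq : (fun s => ∫ x, DefectSq σ N (Φ N) φ s z x) = fun s => X N s z := by
          funext s
          simp only [hXdef, hfm_good N s z hg]
          rfl
        rw [heq] at hz
        exact hz.trans_le (le_abs_self _)
      · right; exact hg
    calc G N {z | δ < ∫ s in Icc 0 t, ∫ x, DefectSq σ N (Φ N) φ s z x}
        ≤ G N ({z | δ < |∫ s in Icc 0 t, X N s z|} ∪ (Φ N).goodᶜ) := measure_mono hincl
      _ ≤ G N {z | δ < |∫ s in Icc 0 t, X N s z|} + G N (Φ N).goodᶜ := measure_union_le _ _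
      _ = _ := by rw [hgood N, add_zero]
  have hshift : Tendsto (fun N : ℕ => G N {z | δ < |∫ s in Icc 0 t, X N s z|}) atTop (𝓝 0) :=
    (tendsto_add_atTop_iff_nat N₂).1 hglue
  exact tendsto_of_tendsto_of_tendsto_of_le_of_le' tendsto_const_nhds hshift
    (Eventually.of_forall fun N => bot_le) (Eventually.of_forall hev)

/-- The time-local tail of the crux at constant profiles: for EVERY flow family (H1 is not needed) the
crux's `CruxTailT` holds — for every `t > 0`, H2 on `[0, t]` (not needed either) gives the conclusion. -/
theorem cruxTailT_const (a θ : ℝ) (u : V3) (ha : 0 < a) (hθ : 0 < θ) {σ : ℝ} (hσ : 0 < σ) (hσ' : σ < 2⁻¹)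
    (Φ : Flows σ) : CruxTailT σ (fun _ => a) (fun _ => θ) (fun _ => u) Φ :=
  cruxTailT_of_conclOn fun _ ht _ => conclOn_const a θ u ha hθ hσ hσ' Φ ht

/-! ## Registered anchor of this support file -/

/-- ANCHOR (registered helper stub `eqRung_anchor` of the crux item): **the crux `AdaptedWeightCLT` holds at
constant profiles**, unconditionally — for constants `a, θ > 0`, `u`, with `σ₀ := 1/2`, every flow family,
with or without diffuse backward influence, satisfies the crux's time-local tail (`adaptedWeightCLT_iff`
restricted to constant profiles, hypothesis H1 discarded). -/
theorem eqRung_anchor : ∀ (a θ : ℝ) (u : V3), 0 < a → 0 < θ → ∃ σ₀ : ℝ, 0 < σ₀ ∧ ∀ σ : ℝ, 0 < σ → σ < σ₀ → ∀ Φ : Flows σ, DiffuseAt σ (fun _ => a) (fun _ => θ) (fun _ => u) Φ → CruxTailT σ (fun _ => a) (fun _ => θ) (fun _ => u) Φ :=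
  fun a θ u ha hθ => ⟨2⁻¹, by norm_num, fun σ hσ hσ' Φ _ => cruxTailT_const a θ u ha hθ hσ hσ' Φ⟩

end EqRung

end

end Summit.AtomisticToContinuum.HydrodynamicLimit.Theorems.ContactBalance
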